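import Literature.Topology.FourManifolds.SegmentConj
import HarnessLib

/-!
# The twist lemma: re-inserting a tiny unit by a linear map fixing the segment direction

Topic `Literature/Topology/FourManifolds` (trunk T-4MAN). Fact seat
`provefact-Literature.Topology.FourManifolds.Knot.IsConnectedSum.isIsotopic` (Schubert's theorem),
geometric heart for rail knots. Companion of the segment conjugation lemma (`SegmentConj.lean`):
there a tiny unit sitting on a chart-straight segment of its host is carried to another host and
re-inserted through the linear map `L = DΦ(o)` of the conjugated isotopy, `L d = d'`. When the two
hosts share the segment (`o = o'`, `d = d'`) one is left with a unit re-inserted by some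
`L ∈ GL⁺(3)` with `L d = d`; this file removes `L`.

* § path: for `d ≠ 0` and a continuous linear map `L` with `L d = d` and `det L > 0` there is a
  `C^∞` path `Λ` of injective continuous linear maps fixing `d` with `Λ 0 = id`, `Λ 1 = L`
  (`TwistPath.exists_path`). In an orthonormal basis `(d/‖d‖, v₁, v₂)`
  (`Orthonormal.exists_orthonormalBasis_extension_of_card_eq`) the matrix of `L` is
  `[[1, a, b], [0, P]]` with `det P = det L > 0` (`dt_eq_det`, `Matrix.det_fin_three`); writing
  `P = R_θ U` (`QR`, `θ = arg` of the first column, `U` upper triangular with positive diagonal)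
  the path is `[[1, τ a, τ b], [0, R_{τθ} ((1 - τ) I + τ U)]]` (`TwistPath.path`), block
  triangular with invertible blocks, hence injective (`path_injective`).
* § twist data / frames (`TwistPath.TwData`, `TwData.Frame`): as in `SegmentConj.lean` a simple
  regular loop with a window whose collars run on the segment `o + [ρ₁, ρ₂] d`, whose window
  points are on that segment piece or within `R₀` of `o` (the unit), and whose other points are
  segment points with clock outside `[ρ₁, ρ₂]`, the north pole, or at chart distance `≥ R₁`
  from `o`; the unit radius `R₀ = min (R₁, min (-ρ₁) ρ₂ ‖d‖) / (2M)` is determined by the data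
  (`M ≥ 1` a bound of `‖Λ τ‖` on `[0, 1]`).
* § the lemma (`TwData.Frame.isIsotopic_baseKnot_outKnot`): the knot of such a frame is isotopic
  to the **twisted knot**, equal to it off the window and to `ψ⁻¹ (o + L (ψ I₀ - o))` on the
  window (`outKnot_circlePt_of_not_mem`, `coe_outKnot_circlePt_of_mem`). Proof: the family
  `u ↦ ψ⁻¹ (o + Λ_u (ψ I₀ - o))` on the window is a family of modifications
  (`Knot.IsModification`): the collars are fixed since `Λ_u d = d`, injectivity and regularity
  come from the injectivity of `Λ_u`, and disjointness from the rest by clock values and the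
  distances `M R₀ < R₁`, `M R₀ < min (-ρ₁) ρ₂ ‖d‖`; then isotopy extension.

Everything is proved; no named facts are introduced.

Design note. `TwData.Frame` repeats the shape of `SegmentConj.SegData.Frame` on purpose: that
structure is indexed by segment data carrying an ambient isotopy `Ψ` and a second segment
`(o', d')`, and its family is `ψ⁻¹ (A (P_{1-u} (Y s)))`; here there is no isotopy, the host is
unchanged, and the family is `ψ⁻¹ (o + Λ_u (Y s - o))`. The dozen bookkeeping lemmas with the
same normalised statements (`coe_baseKnot_circlePt`, `window_subset_Ico`, `contDiffAt_Y`,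
`hasDerivAt_Y`, `fam_of_mem`, …) are one-to-five-line wrappers of tree lemmas about *this*
structure's fields and cannot be shared without changing the accepted file `SegmentConj.lean`.

## References

* M. W. Hirsch, *Differential Topology*, GTM 33, Springer (1976), Ch. 8 §1, Thm. 1.3 (isotopy
  extension). [HirschDT1976]
-/

open scoped Manifold ContDiff Topology Real RealInnerProductSpace
open Function Set Metric Filter

noncomputable section

namespace Literature.Topology.FourManifolds

/-- Local notation: `𝔼 n` is the model Euclidean space `EuclideanSpace ℝ (Fin n)`. -/
local notation "𝔼 " n:arg => EuclideanSpace ℝ (Fin n)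

/-- Local notation: `𝕊 n` is the unit sphere in `EuclideanSpace ℝ (Fin (n + 1))`. -/
local notation "𝕊 " n:arg => (Metric.sphere (0 : EuclideanSpace ℝ (Fin (n + 1))) 1)

attribute [local instance] fact_finrank_euclideanSpace_succ

open KnotsInBall BandData

namespace TwistPath

/-! ### A smooth path in the stabiliser of a vector, from the identity to a given map -/

section Path

variable (v : OrthonormalBasis (Fin 3) ℝ (𝔼 3)) (L : (𝔼 3) →L[ℝ] 𝔼 3)

/-- The matrix entries of `L` in the orthonormal basis `v`: `m i j = ⟪v i, L (v j)⟫`. [folklore] -/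
def ent (i j : Fin 3) : ℝ := ⟪v i, L (v j)⟫

/-- The rank-one maps `x ↦ ⟪v j, x⟫ • v i`. [folklore] -/
def proj (j i : Fin 3) : (𝔼 3) →L[ℝ] 𝔼 3 := (innerSL ℝ (v j)).smulRight (v i)

/-- The rank-one map as a formula. [folklore] -/
@[simp] theorem proj_apply (j i : Fin 3) (x : 𝔼 3) : proj v j i x = ⟪v j, x⟫ • v i := rfl

/-- The rank-one maps have operator norm at most `1`. [folklore] -/
theorem norm_proj_le (j i : Fin 3) : ‖proj v j i‖ ≤ 1 := by
  refine ContinuousLinearMap.opNorm_le_bound _ zero_le_one fun x ↦ ?_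
  rw [proj_apply, norm_smul, v.orthonormal.1 i, mul_one, one_mul]
  simpa [v.orthonormal.1 j] using abs_real_inner_le_norm (v j) x

/-- The length of the first column `(p, r)` of the lower-right block. [folklore] -/
def nrm : ℝ := Real.sqrt (ent v L 1 1 ^ 2 + ent v L 2 1 ^ 2)

/-- The angle of the first column of the lower-right block. [folklore] -/
def ang : ℝ := Complex.arg ⟨ent v L 1 1, ent v L 2 1⟩

/-- The `2 × 2` determinant of the lower-right block. [folklore] -/
def dt : ℝ := ent v L 1 1 * ent v L 2 2 - ent v L 1 2 * ent v L 2 1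

/-- Entries of the interpolated upper-triangular factor `U_τ = (1 - τ) I + τ U`. [folklore] -/
def u11 (τ : ℝ) : ℝ := (1 - τ) + τ * nrm v L
/-- Off-diagonal entry `U₁₂(τ) = τ (p q + r s) / n` of the interpolated triangular factor. [folklore] -/
def u12 (τ : ℝ) : ℝ := τ * ((ent v L 1 1 * ent v L 1 2 + ent v L 2 1 * ent v L 2 2) / nrm v L)
/-- Diagonal entry `U₂₂(τ) = (1 - τ) + τ det / n` of the interpolated triangular factor. [folklore] -/
def u22 (τ : ℝ) : ℝ := (1 - τ) + τ * (dt v L / nrm v L)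

/-- **The path** `Λ τ = ∑ N_τ i j • proj j i` with
`N_τ = [[1, τ a, τ b], [0, R_{τθ} U_τ]]`. [folklore] -/
def path (τ : ℝ) : (𝔼 3) →L[ℝ] 𝔼 3 :=
  proj v 0 0 + (τ * ent v L 0 1) • proj v 1 0 + (τ * ent v L 0 2) • proj v 2 0 +
    (Real.cos (τ * ang v L) * u11 v L τ) • proj v 1 1 +
    (Real.cos (τ * ang v L) * u12 v L τ - Real.sin (τ * ang v L) * u22 v L τ) • proj v 2 1 +
    (Real.sin (τ * ang v L) * u11 v L τ) • proj v 1 2 +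
    (Real.sin (τ * ang v L) * u12 v L τ + Real.cos (τ * ang v L) * u22 v L τ) • proj v 2 2

/-- Inner products of the basis vectors. [folklore] -/
theorem inner_v (i j : Fin 3) : ⟪v i, v j⟫ = if i = j then (1 : ℝ) else 0 :=
  orthonormal_iff_ite.1 v.orthonormal i j

/-- The path applied to a vector, in coordinates. [folklore] -/
theorem path_apply (τ : ℝ) (x : 𝔼 3) :
    path v L τ x = (⟪v 0, x⟫ + τ * ent v L 0 1 * ⟪v 1, x⟫ + τ * ent v L 0 2 * ⟪v 2, x⟫) • v 0 +
      (Real.cos (τ * ang v L) * u11 v L τ * ⟪v 1, x⟫ +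
        (Real.cos (τ * ang v L) * u12 v L τ - Real.sin (τ * ang v L) * u22 v L τ) * ⟪v 2, x⟫) • v 1 +
      (Real.sin (τ * ang v L) * u11 v L τ * ⟪v 1, x⟫ +
        (Real.sin (τ * ang v L) * u12 v L τ + Real.cos (τ * ang v L) * u22 v L τ) * ⟪v 2, x⟫) • v 2 := by
  simp only [path, add_apply, smul_apply, proj_apply, smul_smul]
  simp only [add_smul, mul_assoc]
  abel

/-- The path is `C^∞` in `τ`. [folklore] -/
theorem contDiff_path : ContDiff ℝ ∞ (path v L) := by
  unfold path u11 u12 u22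
  fun_prop

/-- At `τ = 0` the path is the identity. [folklore] -/
theorem path_zero : path v L 0 = ContinuousLinearMap.id ℝ (𝔼 3) := by
  ext x
  -- expand `x` in the basis
  have hx := v.sum_repr' x
  simp only [Fin.sum_univ_three] at hx
  rw [path_apply]
  simp only [zero_mul, Real.cos_zero, Real.sin_zero, u11, u12, u22, sub_zero, one_mul, zero_add, add_zero,
    mul_zero, mul_one, ContinuousLinearMap.id_apply]
  conv_rhs => rw [← hx]


/-- The path fixes `v 0`. [folklore] -/
theorem path_v0 (τ : ℝ) : path v L τ (v 0) = v 0 := by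
  rw [path_apply]
  simp

variable {v L}

/-- The complex number `p + r i` has modulus `n`. [folklore] -/
theorem norm_mk_eq_nrm : ‖(⟨ent v L 1 1, ent v L 2 1⟩ : ℂ)‖ = nrm v L := by
  rw [Complex.norm_eq_sqrt_sq_add_sq]; rfl

/-- Trig identity for the rotation factor at `τ = 1`: `cos θ · n = p`. [folklore] -/
theorem cos_ang_mul_nrm (h : nrm v L ≠ 0) : Real.cos (ang v L) * nrm v L = ent v L 1 1 := by
  have hz : (⟨ent v L 1 1, ent v L 2 1⟩ : ℂ) ≠ 0 := by
    intro h0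
    apply h
    rw [← norm_mk_eq_nrm, h0, norm_zero]
  rw [ang, Complex.cos_arg hz, norm_mk_eq_nrm, div_mul_cancel₀ _ h]

/-- Trig identity for the rotation factor at `τ = 1`: `sin θ · n = r`. [folklore] -/
theorem sin_ang_mul_nrm (h : nrm v L ≠ 0) : Real.sin (ang v L) * nrm v L = ent v L 2 1 := by
  rw [ang, Complex.sin_arg, norm_mk_eq_nrm, div_mul_cancel₀ _ h]

/-- `n ≥ 0`. [folklore] -/
theorem nrm_nonneg : 0 ≤ nrm v L := Real.sqrt_nonneg _

/-- `n² = p² + r²`. [folklore] -/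
theorem nrm_sq : nrm v L ^ 2 = ent v L 1 1 ^ 2 + ent v L 2 1 ^ 2 :=
  Real.sq_sqrt (by positivity)

/-- `U₁₁(1) = n`. [folklore] -/
theorem u11_one : u11 v L 1 = nrm v L := by simp [u11]

/-- `U₁₂(1) = (p q + r s) / n`. [folklore] -/
theorem u12_one : u12 v L 1 = (ent v L 1 1 * ent v L 1 2 + ent v L 2 1 * ent v L 2 2) / nrm v L := by simp [u12]

/-- `U₂₂(1) = det / n`. [folklore] -/
theorem u22_one : u22 v L 1 = dt v L / nrm v L := by simp [u22]

/-- The `(1, 2)` entry of `R_θ U` is `q`. [folklore] -/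
theorem coeff_one_12 (h : nrm v L ≠ 0) :
    Real.cos (ang v L) * u12 v L 1 - Real.sin (ang v L) * u22 v L 1 = ent v L 1 2 := by
  have hc := cos_ang_mul_nrm h
  have hs := sin_ang_mul_nrm h
  have hn2 := nrm_sq (v := v) (L := L)
  rw [u12_one, u22_one]
  refine mul_right_cancel₀ h (mul_right_cancel₀ h ?_)
  have e : (Real.cos (ang v L) * ((ent v L 1 1 * ent v L 1 2 + ent v L 2 1 * ent v L 2 2) / nrm v L) -
      Real.sin (ang v L) * (dt v L / nrm v L)) * nrm v L =
      Real.cos (ang v L) * (ent v L 1 1 * ent v L 1 2 + ent v L 2 1 * ent v L 2 2) - Real.sin (ang v L) * dt v L := by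
    rw [sub_mul, mul_assoc, mul_assoc, div_mul_cancel₀ _ h, div_mul_cancel₀ _ h]
  rw [e, dt]
  linear_combination (ent v L 1 1 * ent v L 1 2 + ent v L 2 1 * ent v L 2 2) * hc -
    (ent v L 1 1 * ent v L 2 2 - ent v L 1 2 * ent v L 2 1) * hs - ent v L 1 2 * hn2

/-- The `(2, 2)` entry of `R_θ U` is `s`. [folklore] -/
theorem coeff_one_22 (h : nrm v L ≠ 0) :
    Real.sin (ang v L) * u12 v L 1 + Real.cos (ang v L) * u22 v L 1 = ent v L 2 2 := by
  have hc := cos_ang_mul_nrm h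
  have hs := sin_ang_mul_nrm h
  have hn2 := nrm_sq (v := v) (L := L)
  rw [u12_one, u22_one]
  refine mul_right_cancel₀ h (mul_right_cancel₀ h ?_)
  have e : (Real.sin (ang v L) * ((ent v L 1 1 * ent v L 1 2 + ent v L 2 1 * ent v L 2 2) / nrm v L) +
      Real.cos (ang v L) * (dt v L / nrm v L)) * nrm v L =
      Real.sin (ang v L) * (ent v L 1 1 * ent v L 1 2 + ent v L 2 1 * ent v L 2 2) + Real.cos (ang v L) * dt v L := by
    rw [add_mul, mul_assoc, mul_assoc, div_mul_cancel₀ _ h, div_mul_cancel₀ _ h]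
  rw [e, dt]
  linear_combination (ent v L 1 1 * ent v L 1 2 + ent v L 2 1 * ent v L 2 2) * hs +
    (ent v L 1 1 * ent v L 2 2 - ent v L 1 2 * ent v L 2 1) * hc - ent v L 2 2 * hn2

/-- The path at `τ = 1` on the basis vectors. [folklore] -/
theorem path_one_basis (hL0 : L (v 0) = v 0) (h : nrm v L ≠ 0) (j : Fin 3) : path v L 1 (v j) = L (v j) := by
  have hc := cos_ang_mul_nrm h
  have hs := sin_ang_mul_nrm h
  have h12 := coeff_one_12 h
  have h22 := coeff_one_22 h
  have hLj : L (v j) = ∑ i, ⟪v i, L (v j)⟫ • v i := (v.sum_repr' (L (v j))).symm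
  rw [hLj, Fin.sum_univ_three, path_apply]
  simp only [one_mul, u11_one, hc, hs, h12, h22]
  fin_cases j
  · simp only [Fin.zero_eta, Fin.isValue, inner_v, if_true, show (1 : Fin 3) ≠ 0 by decide,
      show (2 : Fin 3) ≠ 0 by decide, if_false, mul_zero, add_zero, one_smul, zero_smul, hL0]
  · simp only [Fin.mk_one, Fin.isValue, inner_v, show (0 : Fin 3) ≠ 1 by decide, if_false, if_true,
      show (2 : Fin 3) ≠ 1 by decide, mul_one, mul_zero, add_zero, zero_add]
    rfl
  · simp only [Fin.reduceFinMk, Fin.isValue, inner_v, show (0 : Fin 3) ≠ 2 by decide, if_false,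
      show (1 : Fin 3) ≠ 2 by decide, if_true, mul_zero, zero_add, mul_one, add_zero]
    rfl

/-- At `τ = 1` the path is `L`, provided `L (v 0) = v 0` and the first column of the block is
nonzero. [folklore] -/
theorem path_one (hL0 : L (v 0) = v 0) (h : nrm v L ≠ 0) : path v L 1 = L := by
  ext1 x
  rw [(v.sum_repr' x).symm]
  simp only [Fin.sum_univ_three, map_add, map_smul, path_one_basis hL0 h]

/-- **Injectivity of the path** for `τ ∈ [0, 1]`, when `n ≠ 0` and the block determinant is
positive. [folklore] -/
theorem path_injective (h : nrm v L ≠ 0) (hdt : 0 < dt v L) {τ : ℝ} (hτ : τ ∈ Icc (0 : ℝ) 1) :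
    Injective (path v L τ) := by
  have hn : 0 < nrm v L := lt_of_le_of_ne nrm_nonneg (Ne.symm h)
  have hu11 : 0 < u11 v L τ := by
    rw [u11]
    rcases eq_or_lt_of_le hτ.1 with h0 | h0
    · rw [← h0]; norm_num
    · have : 0 ≤ 1 - τ := by linarith [hτ.2]
      positivity
  have hu22 : 0 < u22 v L τ := by
    rw [u22]
    rcases eq_or_lt_of_le hτ.1 with h0 | h0
    · rw [← h0]; norm_num
    · have : 0 ≤ 1 - τ := by linarith [hτ.2]
      positivity
  rw [injective_iff_map_eq_zero]
  intro x hx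
  set C := Real.cos (τ * ang v L)
  set S := Real.sin (τ * ang v L)
  have hCS : C ^ 2 + S ^ 2 = 1 := Real.cos_sq_add_sin_sq _
  have h0 := congrArg (fun y ↦ ⟪v 0, y⟫) hx
  have h1 := congrArg (fun y ↦ ⟪v 1, y⟫) hx
  have h2 := congrArg (fun y ↦ ⟪v 2, y⟫) hx
  simp only [path_apply, inner_add_right, inner_smul_right, inner_v, inner_zero_right] at h0 h1 h2
  simp only [Fin.isValue, if_true, show (0 : Fin 3) ≠ 1 by decide, show (0 : Fin 3) ≠ 2 by decide,
    show (1 : Fin 3) ≠ 0 by decide, show (1 : Fin 3) ≠ 2 by decide, show (2 : Fin 3) ≠ 0 by decide,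
    show (2 : Fin 3) ≠ 1 by decide, if_false, mul_one, mul_zero, add_zero, zero_add] at h0 h1 h2
  -- combine: `C h1 + S h2` and `-S h1 + C h2`
  have e1 : u11 v L τ * ⟪v 1, x⟫ + u12 v L τ * ⟪v 2, x⟫ = 0 := by
    linear_combination C * h1 + S * h2 - (u11 v L τ * ⟪v 1, x⟫ + u12 v L τ * ⟪v 2, x⟫) * hCS
  have e2 : u22 v L τ * ⟪v 2, x⟫ = 0 := by
    linear_combination (-S) * h1 + C * h2 - (u22 v L τ * ⟪v 2, x⟫) * hCS
  have c2 : ⟪v 2, x⟫ = 0 := (mul_eq_zero.1 e2).resolve_left hu22.ne'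
  have c1 : ⟪v 1, x⟫ = 0 := by
    rw [c2, mul_zero, add_zero] at e1
    exact (mul_eq_zero.1 e1).resolve_left hu11.ne'
  have c0 : ⟪v 0, x⟫ = 0 := by rw [c1, c2] at h0; simpa using h0
  rw [← v.sum_repr' x, Fin.sum_univ_three, c0, c1, c2]
  simp

/-- If the block determinant is nonzero then `n ≠ 0`. [folklore] -/
theorem nrm_ne_zero_of_dt (hdt : dt v L ≠ 0) : nrm v L ≠ 0 := by
  intro h
  have h2 := nrm_sq (v := v) (L := L)
  rw [h] at h2
  have e11 : ent v L 1 1 = 0 := by nlinarith [sq_nonneg (ent v L 1 1), sq_nonneg (ent v L 2 1)]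
  have e21 : ent v L 2 1 = 0 := by nlinarith [sq_nonneg (ent v L 1 1), sq_nonneg (ent v L 2 1)]
  apply hdt
  rw [dt, e11, e21]; ring

/-- **The block determinant is the determinant of `L`** when `L (v 0) = v 0`. [folklore] -/
theorem dt_eq_det (hL0 : L (v 0) = v 0) : dt v L = LinearMap.det (L : (𝔼 3) →ₗ[ℝ] 𝔼 3) := by
  classical
  rw [← LinearMap.det_toMatrix v.toBasis]
  have hM : ∀ i j, LinearMap.toMatrix v.toBasis v.toBasis (L : (𝔼 3) →ₗ[ℝ] 𝔼 3) i j = ent v L i j := by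
    intro i j
    rw [LinearMap.toMatrix_apply, v.coe_toBasis, v.coe_toBasis_repr_apply, v.repr_apply_apply]
    rfl
  rw [Matrix.det_fin_three]
  simp only [hM]
  have c0 : ∀ i, ent v L i 0 = if i = 0 then 1 else 0 := fun i ↦ by
    rw [ent, hL0, inner_v]
  simp only [c0, Fin.isValue, if_true, show (1 : Fin 3) ≠ 0 by decide, show (2 : Fin 3) ≠ 0 by decide, if_false]
  rw [dt]; ring

variable (d : 𝔼 3) (L)

/-- **Existence of the path.** For `d ≠ 0` and a continuous linear map `L` with `L d = d` and
positive determinant there is a `C^∞` path of injective continuous linear maps fixing `d`, from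
the identity to `L`. [folklore] -/
theorem exists_path (hd : d ≠ 0) (hLd : L d = d) (hdet : 0 < LinearMap.det (L : (𝔼 3) →ₗ[ℝ] 𝔼 3)) :
    ∃ Λ : ℝ → ((𝔼 3) →L[ℝ] 𝔼 3), ContDiff ℝ ∞ Λ ∧ Λ 0 = ContinuousLinearMap.id ℝ (𝔼 3) ∧ Λ 1 = L ∧
      (∀ τ, Λ τ d = d) ∧ ∀ τ ∈ Icc (0 : ℝ) 1, Injective (Λ τ) := by
  -- an orthonormal basis with first vector `d / ‖d‖`
  set e : 𝔼 3 := ‖d‖⁻¹ • d with he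
  have hdn : 0 < ‖d‖ := norm_pos_iff.2 hd
  have he1 : ‖e‖ = 1 := by rw [he, norm_smul, norm_inv, norm_norm, inv_mul_cancel₀ hdn.ne']
  have hon : Orthonormal ℝ (({(0 : Fin 3)} : Set (Fin 3)).restrict fun _ : Fin 3 ↦ e) := by
    rw [orthonormal_iff_ite]
    rintro ⟨i, hi⟩ ⟨j, hj⟩
    rw [Set.mem_singleton_iff] at hi hj
    subst hi; subst hj
    simp only [Set.restrict_apply, if_true]
    rw [real_inner_self_eq_norm_sq, he1]; norm_num
  obtain ⟨v, hv⟩ := Orthonormal.exists_orthonormalBasis_extension_of_card_eq (𝕜 := ℝ) (E := 𝔼 3)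
    (ι := Fin 3) (by simp) hon
  have hv0 : v 0 = e := hv 0 rfl
  have hde : d = ‖d‖ • e := by rw [he, smul_smul, mul_inv_cancel₀ hdn.ne', one_smul]
  have hL0 : L (v 0) = v 0 := by
    rw [hv0, he, map_smul, hLd]
  have hdt : dt v L = LinearMap.det (L : (𝔼 3) →ₗ[ℝ] 𝔼 3) := dt_eq_det hL0
  have hdt_pos : 0 < dt v L := hdt ▸ hdet
  have hn : nrm v L ≠ 0 := nrm_ne_zero_of_dt hdt_pos.ne'
  refine ⟨path v L, contDiff_path v L, path_zero v L, path_one hL0 hn, fun τ ↦ ?_, fun τ hτ ↦ path_injective hn hdt_pos hτ⟩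
  rw [hde, map_smul, ← hv0, path_v0]

end Path

/-! ### Twist data and thresholds -/

/-- **Twist data**: a chart point `o`, a direction `d ≠ 0`, a continuous linear map `L` with
`L d = d` and positive determinant, a clock range `[ρ₁, ρ₂] ∋ 0` and a far radius `R₁` with the
segment `o + [ρ₁, ρ₂] d` inside the far ball. [folklore] -/
structure TwData where
  /-- The centre of the segment (chart coordinates). -/
  o : 𝔼 3
  /-- The direction of the segment. -/
  d : 𝔼 3
  /-- The linear re-insertion map. -/
  L : (𝔼 3) →L[ℝ] 𝔼 3
  /-- The clock range. -/
  ρ₁ : ℝ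
  /-- The clock range. -/
  ρ₂ : ℝ
  /-- The far radius. -/
  R₁ : ℝ
  d_ne : d ≠ 0
  L_d : L d = d
  det_pos : 0 < LinearMap.det (L : (𝔼 3) →ₗ[ℝ] 𝔼 3)
  ρ₁_neg : ρ₁ < 0
  ρ₂_pos : 0 < ρ₂
  R₁_pos : 0 < R₁
  seg_far : ∀ ρ ∈ Icc ρ₁ ρ₂, ‖ρ • d‖ < R₁

namespace TwData

variable (D : TwData)

/-- **The path** of injective maps fixing `d`, from the identity to `L`. [folklore] -/
def Λ : ℝ → ((𝔼 3) →L[ℝ] 𝔼 3) := (exists_path D.L D.d D.d_ne D.L_d D.det_pos).choose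

/-- The defining properties of the path. [folklore] -/
theorem Λ_spec : ContDiff ℝ ∞ D.Λ ∧ D.Λ 0 = ContinuousLinearMap.id ℝ (𝔼 3) ∧ D.Λ 1 = D.L ∧
    (∀ τ, D.Λ τ D.d = D.d) ∧ ∀ τ ∈ Icc (0 : ℝ) 1, Injective (D.Λ τ) :=
  (exists_path D.L D.d D.d_ne D.L_d D.det_pos).choose_spec

/-- The path is `C^∞`. [folklore] -/
theorem contDiff_Λ : ContDiff ℝ ∞ D.Λ := D.Λ_spec.1

/-- The path starts at the identity. [folklore] -/
theorem Λ_zero : D.Λ 0 = ContinuousLinearMap.id ℝ (𝔼 3) := D.Λ_spec.2.1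

/-- The path ends at `L`. [folklore] -/
theorem Λ_one : D.Λ 1 = D.L := D.Λ_spec.2.2.1

/-- The path fixes `d`. [folklore] -/
theorem Λ_d (τ : ℝ) : D.Λ τ D.d = D.d := D.Λ_spec.2.2.2.1 τ

/-- The path fixes the multiples of `d`. [folklore] -/
theorem Λ_smul_d (τ ρ : ℝ) : D.Λ τ (ρ • D.d) = ρ • D.d := by rw [map_smul, D.Λ_d]

/-- The maps of the path are injective on `[0, 1]`. [folklore] -/
theorem Λ_injective {τ : ℝ} (hτ : τ ∈ Icc (0 : ℝ) 1) : Injective (D.Λ τ) := D.Λ_spec.2.2.2.2 τ hτ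

/-- A bound for the path on `[0, 1]`. [folklore] -/
theorem exists_bound : ∃ M : ℝ, 1 ≤ M ∧ ∀ τ ∈ Icc (0 : ℝ) 1, ‖D.Λ τ‖ ≤ M := by
  obtain ⟨M, hM⟩ := isCompact_Icc.exists_bound_of_continuousOn (D.contDiff_Λ.continuous.continuousOn (s := Icc (0 : ℝ) 1))
  exact ⟨max M 1, le_max_right _ _, fun τ hτ ↦ (hM τ hτ).trans (le_max_left _ _)⟩

/-- **The norm bound** `M ≥ 1` of the path on `[0, 1]`. [folklore] -/
def M : ℝ := D.exists_bound.choose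

/-- `M ≥ 1`. [folklore] -/
theorem one_le_M : 1 ≤ D.M := D.exists_bound.choose_spec.1

/-- `M > 0`. [folklore] -/
theorem M_pos : 0 < D.M := lt_of_lt_of_le one_pos D.one_le_M

/-- `‖Λ τ‖ ≤ M` on `[0, 1]`. [folklore] -/
theorem norm_Λ_le {τ : ℝ} (hτ : τ ∈ Icc (0 : ℝ) 1) : ‖D.Λ τ‖ ≤ D.M := D.exists_bound.choose_spec.2 τ hτ

/-- **The unit radius**: half of `min (R₁, min (-ρ₁) ρ₂ ‖d‖) / M`. [folklore] -/
def R₀ : ℝ := min D.R₁ (min (-D.ρ₁) D.ρ₂ * ‖D.d‖) / (2 * D.M)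

/-- The numerator of the unit radius is positive. [folklore] -/
theorem min_pos : 0 < min D.R₁ (min (-D.ρ₁) D.ρ₂ * ‖D.d‖) :=
  lt_min D.R₁_pos (mul_pos (lt_min (by linarith [D.ρ₁_neg]) D.ρ₂_pos) (norm_pos_iff.2 D.d_ne))

/-- The unit radius is positive. [folklore] -/
theorem R₀_pos : 0 < D.R₀ := div_pos D.min_pos (by linarith [D.M_pos])

/-- `M R₀` is half the numerator. [folklore] -/
theorem M_mul_R₀ : D.M * D.R₀ = min D.R₁ (min (-D.ρ₁) D.ρ₂ * ‖D.d‖) / 2 := by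
  rw [R₀]; field_simp [D.M_pos.ne']

/-- **Smallness**: `M R₀ < R₁`. [folklore] -/
theorem unit_far : D.M * D.R₀ < D.R₁ := by
  rw [M_mul_R₀]; linarith [min_le_left D.R₁ (min (-D.ρ₁) D.ρ₂ * ‖D.d‖), D.min_pos]

/-- **Smallness**: `M R₀ < min (-ρ₁) ρ₂ ‖d‖`. [folklore] -/
theorem unit_seg : D.M * D.R₀ < min (-D.ρ₁) D.ρ₂ * ‖D.d‖ := by
  rw [M_mul_R₀]; linarith [min_le_right D.R₁ (min (-D.ρ₁) D.ρ₂ * ‖D.d‖), D.min_pos]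

/-- The path maps the unit ball into the ball of radius `M R₀`. [folklore] -/
theorem norm_Λ_apply_le {τ : ℝ} (hτ : τ ∈ Icc (0 : ℝ) 1) {y : 𝔼 3} (hy : y ∈ closedBall D.o D.R₀) :
    ‖D.Λ τ (y - D.o)‖ ≤ D.M * D.R₀ := by
  rw [mem_closedBall, dist_eq_norm] at hy
  exact (ContinuousLinearMap.le_opNorm _ _).trans (mul_le_mul (D.norm_Λ_le hτ) hy (norm_nonneg _) D.M_pos.le)

/-! ### Loop frames -/

/-- **Loop frames** for the twist data: a simple regular loop (piece function `I₀` on `[a, a + 1)`)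
with a window `[w₁, w₂]` and collars `[w₁, c₁]`, `[c₂, w₂]` on which it runs on the segment
with clock in `[ρ₁, ρ₂]`, whose window points are on that segment piece or within `R₀` of `o`
(**the unit**), and whose points off the closed window are segment points with clock outside
`[ρ₁, ρ₂]`, the north pole, or at chart distance `≥ R₁` from `o`. [folklore] -/
structure Frame where
  /-- The piece function. -/
  I₀ : ℝ → 𝔼 4
  /-- The base of the fundamental domain. -/
  a : ℝ
  /-- The seam margin. -/
  ε₀ : ℝ
  /-- The window and its collars. -/
  w₁ : ℝ
  c₁ : ℝ
  c₂ : ℝ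
  w₂ : ℝ
  contDiff : ContDiff ℝ ∞ I₀
  isRegularLoop : IsRegularLoop (periodise a I₀)
  injOn : InjOn I₀ (Ico a (a + 1))
  ε₀_pos : 0 < ε₀
  seam : ∀ t ∈ Ioo (a - ε₀) (a + ε₀), I₀ (t + 1) = I₀ t
  le_w₁ : a + ε₀ ≤ w₁
  w₁_lt : w₁ < c₁
  c₁_lt : c₁ < c₂
  c₂_lt : c₂ < w₂
  w₂_le : w₂ ≤ a + 1 - ε₀
  collar : ∀ s, s ∈ Icc w₁ c₁ ∪ Icc c₂ w₂ → ∃ ρ ∈ Icc D.ρ₁ D.ρ₂, I₀ s = ((psiN.symm (D.o + ρ • D.d) : 𝕊 3) : 𝔼 4)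
  inner : ∀ s ∈ Icc w₁ w₂, (∃ ρ ∈ Icc D.ρ₁ D.ρ₂, I₀ s = ((psiN.symm (D.o + ρ • D.d) : 𝕊 3) : 𝔼 4)) ∨
    ∃ y ∈ closedBall D.o D.R₀, I₀ s = ((psiN.symm y : 𝕊 3) : 𝔼 4)
  off : ∀ t ∈ Ico a (a + 1), t ∉ Icc w₁ w₂ →
    (∃ ρ : ℝ, ρ ∉ Icc D.ρ₁ D.ρ₂ ∧ I₀ t = ((psiN.symm (D.o + ρ • D.d) : 𝕊 3) : 𝔼 4)) ∨
    ∃ x : 𝕊 3, I₀ t = (x : 𝔼 4) ∧ (x = northPole ∨ D.R₁ ≤ ‖psiN x - D.o‖)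

namespace Frame

variable {D} (Fr : D.Frame)

/-- **The base knot** of the frame. [folklore] -/
def baseKnot : Knot := Fr.isRegularLoop.toKnot (periodise_simple_iff.2 Fr.injOn)

/-- The base knot through `circlePt t` is `I₀ t` on the fundamental domain. [folklore] -/
theorem coe_baseKnot_circlePt {t : ℝ} (ht : t ∈ Ico Fr.a (Fr.a + 1)) :
    ((Fr.baseKnot (circlePt t) : 𝕊 3) : 𝔼 4) = Fr.I₀ t := by
  rw [baseKnot, Fr.isRegularLoop.coe_toKnot_circlePt, periodise_eq_self Fr.a _ ht]

/-- The curve of the base knot on the fundamental domain. [folklore] -/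
theorem curve_baseKnot {t : ℝ} (ht : t ∈ Ico Fr.a (Fr.a + 1)) : Knot.curve Fr.baseKnot t = Fr.I₀ t := by
  rw [Knot.curve_apply, Fr.coe_baseKnot_circlePt ht]

/-- The window lies in the fundamental domain. [folklore] -/
theorem window_subset_Ico : Icc Fr.w₁ Fr.w₂ ⊆ Ico Fr.a (Fr.a + 1) := fun s hs ↦
  ⟨by linarith [hs.1, Fr.le_w₁, Fr.ε₀_pos], by linarith [hs.2, Fr.w₂_le, Fr.ε₀_pos]⟩

/-- **The chart curve** `Y s = ψ (base knot (circlePt s))`. [folklore] -/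
def Y (s : ℝ) : 𝔼 3 := psiN (Fr.baseKnot (circlePt s))

/-- **Window points in the chart**: on the segment with clock in `[ρ₁, ρ₂]` or within `R₀` of
`o`; and the knot point is `ψ⁻¹ (Y s)`. [folklore] -/
theorem window_cases {s : ℝ} (hs : s ∈ Icc Fr.w₁ Fr.w₂) :
    ((∃ ρ ∈ Icc D.ρ₁ D.ρ₂, Fr.Y s = D.o + ρ • D.d) ∨ Fr.Y s ∈ closedBall D.o D.R₀) ∧
      Fr.baseKnot (circlePt s) = psiN.symm (Fr.Y s) := by
  have hco := Fr.coe_baseKnot_circlePt (Fr.window_subset_Ico hs)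
  have key : ∀ {y : 𝔼 3}, Fr.I₀ s = ((psiN.symm y : 𝕊 3) : 𝔼 4) → Fr.Y s = y ∧ Fr.baseKnot (circlePt s) = psiN.symm (Fr.Y s) :=
    fun {y} he ↦ by
    have h1 : Fr.baseKnot (circlePt s) = psiN.symm y := Subtype.ext (hco.trans he)
    have h2 : Fr.Y s = y := by rw [Y, h1, psiN_apply_psiN_symm]
    exact ⟨h2, by rw [h2]; exact h1⟩
  rcases Fr.inner s hs with ⟨ρ, hρ, he⟩ | ⟨y, hy, he⟩
  · exact ⟨Or.inl ⟨ρ, hρ, (key he).1⟩, (key he).2⟩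
  · exact ⟨Or.inr (by rw [(key he).1]; exact hy), (key he).2⟩

/-- **Collar points in the chart**: on the segment with clock in `[ρ₁, ρ₂]`. [folklore] -/
theorem collar_cases {s : ℝ} (hs : s ∈ Icc Fr.w₁ Fr.c₁ ∪ Icc Fr.c₂ Fr.w₂) :
    (∃ ρ ∈ Icc D.ρ₁ D.ρ₂, Fr.Y s = D.o + ρ • D.d) ∧ Fr.baseKnot (circlePt s) = psiN.symm (Fr.Y s) := by
  have hsW : s ∈ Icc Fr.w₁ Fr.w₂ := by
    rcases hs with h | h
    · exact ⟨h.1, by linarith [h.2, Fr.c₁_lt, Fr.c₂_lt]⟩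
    · exact ⟨by linarith [h.1, Fr.w₁_lt, Fr.c₁_lt], h.2⟩
  have hco := Fr.coe_baseKnot_circlePt (Fr.window_subset_Ico hsW)
  obtain ⟨ρ, hρ, he⟩ := Fr.collar s hs
  have h1 : Fr.baseKnot (circlePt s) = psiN.symm (D.o + ρ • D.d) := Subtype.ext (hco.trans he)
  have h2 : Fr.Y s = D.o + ρ • D.d := by rw [Y, h1, psiN_apply_psiN_symm]
  exact ⟨⟨ρ, hρ, h2⟩, by rw [h2]; exact h1⟩

/-- Window points lie within `max (M R₀) R₁`... more precisely: a window point is within `R₁` of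
`o` in the chart. [folklore] -/
theorem norm_Y_sub_lt {s : ℝ} (hs : s ∈ Icc Fr.w₁ Fr.w₂) : ‖Fr.Y s - D.o‖ < D.R₁ := by
  rcases (Fr.window_cases hs).1 with ⟨ρ, hρ, he⟩ | hy
  · rw [he, add_sub_cancel_left]; exact D.seg_far ρ hρ
  · rw [mem_closedBall, dist_eq_norm] at hy
    have h1 : D.R₀ ≤ D.M * D.R₀ := le_mul_of_one_le_left D.R₀_pos.le D.one_le_M
    linarith [D.unit_far]

/-! ### The chart curve: smoothness and regularity -/

/-- The chart curve is `C^∞` at parameters whose knot point is not the north pole. [folklore] -/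
theorem contDiffAt_Y {s : ℝ} (hne : Fr.baseKnot (circlePt s) ≠ northPole) : ContDiffAt ℝ ∞ Fr.Y s := by
  have h1 : ContMDiffAt 𝓘(ℝ, ℝ) (𝓡 3) ∞ (fun s ↦ Fr.baseKnot (circlePt s)) s :=
    (Fr.baseKnot.contMDiff.comp contMDiff_circlePt) s
  have h2 : ContMDiffAt (𝓡 3) 𝓘(ℝ, 𝔼 3) ∞ psiN (Fr.baseKnot (circlePt s)) := isFullChart_psiN.contMDiffAt (mem_psiN_source hne)
  exact contMDiffAt_iff_contDiffAt.1 (h2.comp s h1)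

/-- On the window the knot point is not the north pole. [folklore] -/
theorem baseKnot_ne_northPole {s : ℝ} (hs : s ∈ Icc Fr.w₁ Fr.w₂) : Fr.baseKnot (circlePt s) ≠ northPole := by
  rw [(Fr.window_cases hs).2]; exact psiN_symm_ne_northPole _

/-- **The chart curve is regular on the window.** [folklore] -/
theorem hasDerivAt_Y {s : ℝ} (hs : s ∈ Icc Fr.w₁ Fr.w₂) : HasDerivAt Fr.Y (deriv Fr.Y s) s ∧ deriv Fr.Y s ≠ 0 := by
  have hne := Fr.baseKnot_ne_northPole hs
  have hY : HasDerivAt Fr.Y (deriv Fr.Y s) s := ((Fr.contDiffAt_Y hne).differentiableAt (by simp)).hasDerivAt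
  refine ⟨hY, fun h0 ↦ ?_⟩
  have hsI : s ∈ Ioo Fr.a (Fr.a + 1) := ⟨by linarith [hs.1, Fr.le_w₁, Fr.ε₀_pos], by linarith [hs.2, Fr.w₂_le, Fr.ε₀_pos]⟩
  have hopen : IsOpen ({s' : ℝ | Fr.baseKnot (circlePt s') ≠ northPole} ∩ Ioo Fr.a (Fr.a + 1)) :=
    (isOpen_ne.preimage (Fr.baseKnot.continuous.comp contMDiff_circlePt.continuous)).inter isOpen_Ioo
  have hev : Fr.I₀ =ᶠ[𝓝 s] fun s' ↦ ((psiN.symm (Fr.Y s') : 𝕊 3) : 𝔼 4) := by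
    filter_upwards [hopen.mem_nhds ⟨hne, hsI⟩] with s' hs'
    rw [Y, psiN_symm_apply_psiN hs'.1, Fr.coe_baseKnot_circlePt (Ioo_subset_Ico_self hs'.2)]
  have hc := ((contDiff_coe_psiN_symm.differentiable (by simp)) (Fr.Y s)).hasFDerivAt.comp_hasDerivAt s hY
  rw [h0, map_zero] at hc
  have hd : deriv Fr.I₀ s = 0 := by rw [hev.deriv_eq]; exact hc.deriv
  exact Fr.isRegularLoop.deriv_ne_zero_of_mem Fr.ε₀_pos Fr.seam (Ioo_subset_Ico_self hsI) hd

/-! ### The family of modifications -/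

/-- **The inserted pieces**: `ψ⁻¹ (o + Λ_u (Y s - o))`. [folklore] -/
def ins (u s : ℝ) : 𝔼 4 :=
  ((psiN.symm (D.o + D.Λ u (Fr.Y s - D.o)) : 𝕊 3) : 𝔼 4)

/-- **The family**: the inserted pieces on the open window, the base knot elsewhere. [folklore] -/
def fam (u s : ℝ) : 𝔼 4 := by
  classical exact if s ∈ Ioo Fr.w₁ Fr.w₂ then Fr.ins u s else Knot.curve Fr.baseKnot s

/-- On the open window the family is the inserted piece. [folklore] -/
theorem fam_of_mem (u : ℝ) {s : ℝ} (hs : s ∈ Ioo Fr.w₁ Fr.w₂) : Fr.fam u s = Fr.ins u s := by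
  simp only [fam]; rw [if_pos hs]

/-- Off the open window the family is the base knot. [folklore] -/
theorem fam_of_not_mem (u : ℝ) {s : ℝ} (hs : s ∉ Ioo Fr.w₁ Fr.w₂) : Fr.fam u s = Knot.curve Fr.baseKnot s := by
  simp only [fam]; rw [if_neg hs]

/-- **Collar agreement**: on the collars every inserted piece is the base knot (`Λ_u d = d`).
[folklore] -/
theorem ins_eq_curve_of_collar (u : ℝ) {s : ℝ} (hs : s ∈ Icc Fr.w₁ Fr.c₁ ∪ Icc Fr.c₂ Fr.w₂) :
    Fr.ins u s = Knot.curve Fr.baseKnot s := by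
  obtain ⟨⟨ρ, -, hY⟩, hK⟩ := Fr.collar_cases hs
  rw [ins, hY, add_sub_cancel_left, D.Λ_smul_d, Knot.curve_apply, hK, hY]

/-- On the window the family is the inserted piece (also at the end points). [folklore] -/
theorem fam_eq_ins_of_mem_window (u : ℝ) {s : ℝ} (hs : s ∈ Icc Fr.w₁ Fr.w₂) : Fr.fam u s = Fr.ins u s := by
  by_cases h : s ∈ Ioo Fr.w₁ Fr.w₂
  · exact Fr.fam_of_mem u h
  · rw [Fr.fam_of_not_mem u h]
    rw [mem_Ioo, not_and_or, not_lt, not_lt] at h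
    rcases h with h | h
    · exact (Fr.ins_eq_curve_of_collar u (Or.inl ⟨hs.1, by linarith [Fr.w₁_lt]⟩)).symm
    · exact (Fr.ins_eq_curve_of_collar u (Or.inr ⟨by linarith [Fr.c₂_lt], hs.2⟩)).symm

/-- Left of `c₁` the family is the base knot. [folklore] -/
theorem fam_eq_curve_of_lt (u : ℝ) {s : ℝ} (hs : s < Fr.c₁) : Fr.fam u s = Knot.curve Fr.baseKnot s := by
  by_cases h : s ∈ Ioo Fr.w₁ Fr.w₂
  · rw [Fr.fam_of_mem u h]; exact Fr.ins_eq_curve_of_collar u (Or.inl ⟨h.1.le, hs.le⟩)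
  · exact Fr.fam_of_not_mem u h

/-- Right of `c₂` the family is the base knot. [folklore] -/
theorem fam_eq_curve_of_gt (u : ℝ) {s : ℝ} (hs : Fr.c₂ < s) : Fr.fam u s = Knot.curve Fr.baseKnot s := by
  by_cases h : s ∈ Ioo Fr.w₁ Fr.w₂
  · rw [Fr.fam_of_mem u h]; exact Fr.ins_eq_curve_of_collar u (Or.inr ⟨hs.le, h.2.le⟩)
  · exact Fr.fam_of_not_mem u h

/-- **At `u = 0` the family is the base knot** (`Λ_0 = id`). [folklore] -/
theorem fam_zero (s : ℝ) : Fr.fam 0 s = Knot.curve Fr.baseKnot s := by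
  by_cases h : s ∈ Ioo Fr.w₁ Fr.w₂
  · have hs := Ioo_subset_Icc_self h
    rw [Fr.fam_of_mem 0 h, ins, D.Λ_zero, ContinuousLinearMap.id_apply, add_sub_cancel, Knot.curve_apply,
      (Fr.window_cases hs).2]
  · exact Fr.fam_of_not_mem 0 h

/-- The inserted pieces are jointly `C^∞` at window parameters. [folklore] -/
theorem contDiffAt_ins {u s : ℝ} (hs : s ∈ Icc Fr.w₁ Fr.w₂) : ContDiffAt ℝ ∞ (uncurry Fr.ins) (u, s) := by
  have hY : ContDiffAt ℝ ∞ (fun p : ℝ × ℝ ↦ Fr.Y p.2 - D.o) (u, s) :=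
    (ContDiffAt.comp (g := Fr.Y) (f := Prod.snd) (u, s) (Fr.contDiffAt_Y (Fr.baseKnot_ne_northPole hs)) contDiffAt_snd).sub
      contDiffAt_const
  have hΛ : ContDiffAt ℝ ∞ (fun p : ℝ × ℝ ↦ D.Λ p.1) (u, s) := (D.contDiff_Λ.comp contDiff_fst).contDiffAt
  have hQ : ContDiffAt ℝ ∞ (fun p : ℝ × ℝ ↦ D.o + D.Λ p.1 (Fr.Y p.2 - D.o)) (u, s) := contDiffAt_const.add (hΛ.clm_apply hY)
  exact contDiff_coe_psiN_symm.contDiffAt.comp (u, s) hQ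

/-- **The family is jointly `C^∞`.** [folklore] -/
theorem contDiff_fam : ContDiff ℝ ∞ (uncurry Fr.fam) := by
  rw [contDiff_iff_contDiffAt]
  rintro ⟨u, s⟩
  by_cases h : s ∈ Ioo Fr.w₁ Fr.w₂
  · have hev : uncurry Fr.fam =ᶠ[𝓝 (u, s)] uncurry Fr.ins := by
      have hopen : IsOpen {p : ℝ × ℝ | p.2 ∈ Ioo Fr.w₁ Fr.w₂} := isOpen_Ioo.preimage continuous_snd
      filter_upwards [hopen.mem_nhds (show (u, s) ∈ {p : ℝ × ℝ | p.2 ∈ Ioo Fr.w₁ Fr.w₂} from h)] with p hp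
      exact Fr.fam_of_mem p.1 hp
    exact (Fr.contDiffAt_ins (Ioo_subset_Icc_self h)).congr_of_eventuallyEq hev
  · have hcurve : ContDiffAt ℝ ∞ (fun p : ℝ × ℝ ↦ Knot.curve Fr.baseKnot p.2) (u, s) :=
      (Fr.baseKnot.contDiff_curve.comp contDiff_snd).contDiffAt
    rw [mem_Ioo, not_and_or, not_lt, not_lt] at h
    rcases h with h | h
    · have hev : uncurry Fr.fam =ᶠ[𝓝 (u, s)] fun p : ℝ × ℝ ↦ Knot.curve Fr.baseKnot p.2 := by
        have hopen : IsOpen {p : ℝ × ℝ | p.2 < Fr.c₁} := isOpen_Iio.preimage continuous_snd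
        filter_upwards [hopen.mem_nhds (show (u, s) ∈ {p : ℝ × ℝ | p.2 < Fr.c₁} by simp only [mem_setOf_eq]; linarith [Fr.w₁_lt])] with p hp
        exact Fr.fam_eq_curve_of_lt p.1 hp
      exact hcurve.congr_of_eventuallyEq hev
    · have hev : uncurry Fr.fam =ᶠ[𝓝 (u, s)] fun p : ℝ × ℝ ↦ Knot.curve Fr.baseKnot p.2 := by
        have hopen : IsOpen {p : ℝ × ℝ | Fr.c₂ < p.2} := isOpen_Ioi.preimage continuous_snd
        filter_upwards [hopen.mem_nhds (show (u, s) ∈ {p : ℝ × ℝ | Fr.c₂ < p.2} by simp only [mem_setOf_eq]; linarith [Fr.c₂_lt])] with p hp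
        exact Fr.fam_eq_curve_of_gt p.1 hp
      exact hcurve.congr_of_eventuallyEq hev

/-- The family is a unit vector on the window. [folklore] -/
theorem norm_fam (u : ℝ) {s : ℝ} (hs : s ∈ Icc Fr.w₁ Fr.w₂) : ‖Fr.fam u s‖ = 1 := by
  rw [Fr.fam_eq_ins_of_mem_window u hs, ins]; exact norm_eq_of_mem_sphere _

/-- **The family is regular on the window** (`u ∈ [0, 1]`). [folklore] -/
theorem deriv_fam_ne_zero {u : ℝ} (hu : u ∈ Icc (0 : ℝ) 1) {s : ℝ} (hs : s ∈ Icc Fr.w₁ Fr.w₂) : deriv (Fr.fam u) s ≠ 0 := by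
  by_cases h1 : s < Fr.c₁
  · have hev : Fr.fam u =ᶠ[𝓝 s] Knot.curve Fr.baseKnot := by
      filter_upwards [Iio_mem_nhds h1] with s' hs' using Fr.fam_eq_curve_of_lt u hs'
    rw [hev.deriv_eq]; exact Fr.baseKnot.deriv_curve_ne_zero s
  by_cases h2 : Fr.c₂ < s
  · have hev : Fr.fam u =ᶠ[𝓝 s] Knot.curve Fr.baseKnot := by
      filter_upwards [Ioi_mem_nhds h2] with s' hs' using Fr.fam_eq_curve_of_gt u hs'
    rw [hev.deriv_eq]; exact Fr.baseKnot.deriv_curve_ne_zero s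
  push Not at h1 h2
  have hIoo : s ∈ Ioo Fr.w₁ Fr.w₂ := ⟨by linarith [Fr.w₁_lt], by linarith [Fr.c₂_lt]⟩
  have hev : Fr.fam u =ᶠ[𝓝 s] Fr.ins u := by
    filter_upwards [Ioo_mem_nhds hIoo.1 hIoo.2] with s' hs' using Fr.fam_of_mem u hs'
  rw [hev.deriv_eq]
  obtain ⟨hY, hY0⟩ := Fr.hasDerivAt_Y hs
  have hc : HasDerivAt (fun s ↦ D.o + D.Λ u (Fr.Y s - D.o)) (D.Λ u (deriv Fr.Y s)) s := by
    have := ((D.Λ u).hasFDerivAt.comp_hasDerivAt s (hY.sub_const D.o)).const_add D.o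
    simpa using this
  have hne : D.Λ u (deriv Fr.Y s) ≠ 0 := fun h0 ↦ hY0 (D.Λ_injective hu (by rw [h0, map_zero]))
  exact deriv_coe_psiN_symm_comp_ne_zero hc hne

/-- **The family is injective on the window** (`u ∈ [0, 1]`). [folklore] -/
theorem injOn_fam {u : ℝ} (hu : u ∈ Icc (0 : ℝ) 1) : InjOn (Fr.fam u) (Icc Fr.w₁ Fr.w₂) := by
  intro s hs s' hs' he
  rw [Fr.fam_eq_ins_of_mem_window u hs, Fr.fam_eq_ins_of_mem_window u hs', ins, ins] at he
  have h1 : D.Λ u (Fr.Y s - D.o) = D.Λ u (Fr.Y s' - D.o) := add_left_cancel (coe_psiN_symm_injective he)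
  have h2 : Fr.Y s = Fr.Y s' := sub_left_injective (D.Λ_injective hu h1)
  have h3 : Fr.I₀ s = Fr.I₀ s' := by
    rw [← Fr.coe_baseKnot_circlePt (Fr.window_subset_Ico hs), ← Fr.coe_baseKnot_circlePt (Fr.window_subset_Ico hs'),
      (Fr.window_cases hs).2, (Fr.window_cases hs').2, h2]
  exact Fr.injOn (Fr.window_subset_Ico hs) (Fr.window_subset_Ico hs') h3

/-- **The inserted pieces in the chart**: for a window parameter `s` and `u ∈ [0, 1]` the chart
value `o + Λ_u (Y s - o)` is `o + ρ d` with `ρ ∈ [ρ₁, ρ₂]` (segment type) or lies within `M R₀`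
of `o` (unit type). [folklore] -/
theorem ins_cases {u : ℝ} (hu : u ∈ Icc (0 : ℝ) 1) {s : ℝ} (hs : s ∈ Icc Fr.w₁ Fr.w₂) :
    (∃ ρ ∈ Icc D.ρ₁ D.ρ₂, D.o + D.Λ u (Fr.Y s - D.o) = D.o + ρ • D.d) ∨
      ‖D.Λ u (Fr.Y s - D.o)‖ ≤ D.M * D.R₀ := by
  rcases (Fr.window_cases hs).1 with ⟨ρ, hρ, hY⟩ | hy
  · exact Or.inl ⟨ρ, hρ, by rw [hY, add_sub_cancel_left, D.Λ_smul_d]⟩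
  · exact Or.inr (D.norm_Λ_apply_le hu hy)

/-- **The family avoids the base knot off the window** (`u ∈ [0, 1]`). [folklore] -/
theorem fam_ne_curve {u : ℝ} (hu : u ∈ Icc (0 : ℝ) 1) {s : ℝ} (hs : s ∈ Icc Fr.w₁ Fr.w₂) {t : ℝ} (ht : t ∈ Ico Fr.a (Fr.a + 1))
    (hts : t ∉ Icc Fr.w₁ Fr.w₂) : Fr.fam u s ≠ Knot.curve Fr.baseKnot t := by
  have hd : 0 < ‖D.d‖ := norm_pos_iff.2 D.d_ne
  rw [Fr.fam_eq_ins_of_mem_window u hs, ins, Fr.curve_baseKnot ht]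
  rcases Fr.off t ht hts with ⟨ρ, hρn, he⟩ | ⟨x, he, hx⟩
  · -- a segment point with clock outside the window range
    rw [he]
    intro heq
    have hZ : D.o + D.Λ u (Fr.Y s - D.o) = D.o + ρ • D.d := coe_psiN_symm_injective heq
    rcases Fr.ins_cases hu hs with ⟨ρ', hρ', hZ'⟩ | hZ'
    · have : ρ' = ρ := smul_left_injective ℝ D.d_ne (add_left_cancel (hZ'.symm.trans hZ))
      exact hρn (this ▸ hρ')
    · rw [add_left_cancel hZ, norm_smul, Real.norm_eq_abs] at hZ'
      have habs : min (-D.ρ₁) D.ρ₂ ≤ |ρ| := by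
        rw [mem_Icc, not_and_or, not_le, not_le] at hρn
        rcases hρn with h | h
        · rcases le_or_gt 0 ρ with h' | h'
          · linarith [D.ρ₁_neg]
          · rw [abs_of_neg h']; exact (min_le_left _ _).trans (by linarith)
        · rw [abs_of_pos (by linarith [D.ρ₂_pos])]; exact (min_le_right _ _).trans h.le
      have := D.unit_seg
      nlinarith
  · -- the north pole, or a point far from `o`
    rw [he]
    intro heq
    have hx1 : psiN.symm (D.o + D.Λ u (Fr.Y s - D.o)) = x := Subtype.ext heq
    rcases hx with hN | hfar
    · rw [hN] at hx1; exact psiN_symm_ne_northPole _ hx1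
    · rw [← hx1, psiN_apply_psiN_symm, add_sub_cancel_left] at hfar
      rcases Fr.ins_cases hu hs with ⟨ρ', hρ', hZ'⟩ | hZ'
      · rw [add_left_cancel hZ'] at hfar
        linarith [D.seg_far ρ' hρ']
      · linarith [D.unit_far]

/-- **The family of modifications of the base knot.** [folklore] -/
theorem isModification : Fr.baseKnot.IsModification Fr.a Fr.ε₀ Fr.fam (Icc Fr.w₁ Fr.w₂) where
  ε_pos := Fr.ε₀_pos
  contDiff := Fr.contDiff_fam
  subset := Icc_subset_Icc Fr.le_w₁ Fr.w₂_le
  isClosed := isClosed_Icc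
  eq_curve u _ ht := Fr.fam_of_not_mem u (fun h ↦ ht (Ioo_subset_Icc_self h))
  zero_eq := Fr.fam_zero
  norm_eq_one u _ _ hs := Fr.norm_fam u hs
  deriv_ne_zero _ hu _ hs := Fr.deriv_fam_ne_zero hu hs
  injOn _ hu := Fr.injOn_fam hu
  disjoint _ hu _ hs _ ht hts := Fr.fam_ne_curve hu hs ht hts

/-- **The twisted knot**: the base knot with the unit re-inserted by `L`. [folklore] -/
def outKnot : Knot := Fr.isModification.knotAt 1

/-- **THE TWIST LEMMA.** The base knot of a loop frame is isotopic to the twisted knot.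
[cite: HirschDT1976, Ch. 8 §1, Thm. 1.3] -/
theorem isIsotopic_baseKnot_outKnot : Fr.baseKnot.IsIsotopic Fr.outKnot := by
  obtain ⟨Θ, -, hΘ, -⟩ := Fr.isModification.exists_ambientIsotopy isOpen_univ (fun y hy ↦ absurd (mem_univ y) hy)
  exact ⟨Θ, hΘ 1 ⟨zero_le_one, le_rfl⟩⟩

/-- **The twisted knot off the window** is the base knot. [folklore] -/
theorem outKnot_circlePt_of_not_mem {t : ℝ} (ht : t ∈ Ico Fr.a (Fr.a + 1)) (hts : t ∉ Icc Fr.w₁ Fr.w₂) :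
    Fr.outKnot (circlePt t) = Fr.baseKnot (circlePt t) := by
  rw [outKnot, Fr.isModification.knotAt_apply_of_forall_not_mem 1 (fun s hs he ↦ ?_)]
  obtain ⟨m, hm⟩ := circlePt_eq_circlePt_iff.1 he
  have hsI := Fr.window_subset_Ico hs
  have h1 : (m : ℝ) < 1 := by linarith [hsI.2, ht.1]
  have h2 : (-1 : ℝ) < m := by linarith [hsI.1, ht.2]
  have h1' : m < 1 := by exact_mod_cast h1
  have h2' : -1 < m := by exact_mod_cast h2
  obtain rfl : m = 0 := by omega
  simp only [Int.cast_zero, add_zero] at hm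
  exact hts (hm ▸ hs)

/-- **The twisted knot on the window** is `ψ⁻¹ (o + L (Y s - o))`. [folklore] -/
theorem coe_outKnot_circlePt_of_mem {s : ℝ} (hs : s ∈ Icc Fr.w₁ Fr.w₂) :
    ((Fr.outKnot (circlePt s) : 𝕊 3) : 𝔼 4) = ((psiN.symm (D.o + D.L (Fr.Y s - D.o)) : 𝕊 3) : 𝔼 4) := by
  rw [outKnot, Fr.isModification.coe_knotAt_circlePt_of_mem 1 hs, Real.smoothTransition.one,
    Fr.fam_eq_ins_of_mem_window 1 hs, ins, D.Λ_one]

end Frame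

end TwData

end TwistPath

end Literature.Topology.FourManifolds
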